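import Mathlib.Topology.Algebra.InfiniteSum.ENNReal
import Summits.CriticalPhenomena.SAWScalingLimit.Theorems.SAWTotalPositivityBoundaryTP2Defs
import Summits.CriticalPhenomena.SAWScalingLimit.Theorems.SAWTotalPositivityBoundaryTP2StarArms
import HarnessLib

/-!
# Crux `BoundaryTP2` (stmt-CriticalPhenomena-7115), line `corner-deletion-induction`: the three-arm star
decomposition of the corner remainder (stub `stub_starDecomposition`)

For the fugacity-`x` self-avoiding path kernel `Z = pathKernel H x` of a simple graph `H` and a corner `p₃`
of a quadruple `p₁ p₂ p₃ p₄` (`p₃ ∉ {p₁, p₂, p₄}`), the corner recursion (`stub_cornerRecursion`) leaves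
the remainder `V₁₂ Z₃₄ − V₂₄ Z₁₃`, where `V(a,b) = pathKernelOn H x a b {γ | p₃ ∈ γ}` is the kernel of the
paths THROUGH the corner. This file rewrites both products as sums over **three-arm stars** at `p₃`:
with `H' = H − p₃` (Mathlib: `H.deleteEdges (H.incidenceSet p₃)`, same vertex type, `p₃` isolated), arms
`α : p₁ → a`, `β : b → p₂`, `γ : c → p₄` self-avoiding in `H'` from neighbours `a b c` of `p₃`, weight
`x^{|α|} x^{|β|} x^{|γ|}` and `T(P) = x³ · Σ_{stars with P} weight`,

  `V₁₂ Z₃₄ = T(α ⊥ β ∧ β ⊥ γ) + T(α ⊥ β ∧ ¬ β ⊥ γ)`,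
  `V₂₄ Z₁₃ = T(α ⊥ β ∧ β ⊥ γ) + T(β ⊥ γ ∧ ¬ α ⊥ β)`

(`⊥` = vertex-disjoint supports; `stub_starDecomposition`, the registered stub). It is the product of
the two-arm decomposition of `V` (`pathKernelOn_visit_eq_tsum_arms`, file `…BoundaryTP2StarArms.lean`:
a path through `p₃` is `α · (a p₃ b) · β` with `α ⊥ β`, bijectively) with the one-arm decomposition of
`Z₃₄` (first step) resp. `Z₁₃` (last step), followed by the bookkeeping of unconditional sums in `ℝ≥0∞`
(`ENNReal.tsum_mul_left/right`, `ENNReal.tsum_comm`, `ENNReal.tsum_add`) and the pointwise splitting of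
the indicator `[α ⊥ β]` according to `β ⊥ γ` (resp. of `[β ⊥ γ]` according to `α ⊥ β`). No finiteness
of `H` is needed. Everything is proved. [folklore]
-/

noncomputable section

namespace Summit.CriticalPhenomena.SAWScalingLimit.Theorems.BoundaryTP2

open scoped ENNReal

/-- Cyclic reordering of a triple unconditional sum in `ℝ≥0∞`. [folklore] -/
private theorem tsum_comm₃ {ι κ μ : Type*} (f : ι → κ → μ → ℝ≥0∞) :
    ∑' (i) (k) (m), f i k m = ∑' (m) (i) (k), f i k m :=
  (tsum_congr fun _ => ENNReal.tsum_comm).trans ENNReal.tsum_comm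

/-! ## The registered stub -/

open Classical in
/-- **Three-arm star decomposition of the corner remainder** (registered stub `stub_starDecomposition`
of the line `corner-deletion-induction` of crux `BoundaryTP2`; any simple graph, any `x ≥ 0`, no
finiteness). With `H' = H − p₃ = H.deleteEdges (H.incidenceSet p₃)`, arms `α : p₁ → a`, `β : b → p₂`,
`γ : c → p₄` self-avoiding in `H'` from neighbours `a b c` of `p₃`, weight `x^{|α|} x^{|β|} x^{|γ|}` and
`T(P) = x³ ·` (sum of the weights of the stars satisfying `P`):
`V₁₂ · Z₃₄ = T(α ⊥ β ∧ β ⊥ γ) + T(α ⊥ β ∧ ¬ β ⊥ γ)` and `V₂₄ · Z₁₃ = T(α ⊥ β ∧ β ⊥ γ) + T(β ⊥ γ ∧ ¬ α ⊥ β)`,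
where `V(a,b)` is the kernel of the paths through `p₃` and `⊥` is vertex-disjointness of supports.
Proof: a path `p₁ → p₂` through `p₃` is `α · (a p₃ b) · β` with `α ⊥ β`
(`pathKernelOn_visit_eq_tsum_arms`), `Z(p₃,p₄) = x Σ_c Σ_γ x^{|γ|}` (first step), multiply and split
`[α ⊥ β] = [α ⊥ β ∧ β ⊥ γ] + [α ⊥ β ∧ ¬ β ⊥ γ]`; symmetrically for `V₂₄ Z₁₃` with the arm `β` reversed and
the last-step decomposition of `Z(p₁,p₃)`. [folklore] -/
theorem stub_starDecomposition {V : Type*} (H : SimpleGraph V) (x : ℝ) (hx : 0 ≤ x) (p₁ p₂ p₃ p₄ : V)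
    (h₁ : p₃ ≠ p₁) (h₂ : p₃ ≠ p₂) (h₄ : p₃ ≠ p₄) :
    (pathKernelOn H x p₁ p₂ {γ | p₃ ∈ γ.1.support} * pathKernel H x p₃ p₄ =
      ENNReal.ofReal x ^ 3 *
          (∑' (a : H.neighborSet p₃) (b : H.neighborSet p₃) (c : H.neighborSet p₃)
              (α : (H.deleteEdges (H.incidenceSet p₃)).Path p₁ a)
              (β : (H.deleteEdges (H.incidenceSet p₃)).Path b p₂)
              (γ : (H.deleteEdges (H.incidenceSet p₃)).Path c p₄),
            if List.Disjoint α.1.support β.1.support ∧ List.Disjoint β.1.support γ.1.support then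
              ENNReal.ofReal (x ^ α.1.length) * ENNReal.ofReal (x ^ β.1.length) *
                ENNReal.ofReal (x ^ γ.1.length)
            else 0)
        + ENNReal.ofReal x ^ 3 *
          (∑' (a : H.neighborSet p₃) (b : H.neighborSet p₃) (c : H.neighborSet p₃)
              (α : (H.deleteEdges (H.incidenceSet p₃)).Path p₁ a)
              (β : (H.deleteEdges (H.incidenceSet p₃)).Path b p₂)
              (γ : (H.deleteEdges (H.incidenceSet p₃)).Path c p₄),
            if List.Disjoint α.1.support β.1.support ∧ ¬ List.Disjoint β.1.support γ.1.support then
              ENNReal.ofReal (x ^ α.1.length) * ENNReal.ofReal (x ^ β.1.length) *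
                ENNReal.ofReal (x ^ γ.1.length)
            else 0)) ∧
    (pathKernelOn H x p₂ p₄ {γ | p₃ ∈ γ.1.support} * pathKernel H x p₁ p₃ =
      ENNReal.ofReal x ^ 3 *
          (∑' (a : H.neighborSet p₃) (b : H.neighborSet p₃) (c : H.neighborSet p₃)
              (α : (H.deleteEdges (H.incidenceSet p₃)).Path p₁ a)
              (β : (H.deleteEdges (H.incidenceSet p₃)).Path b p₂)
              (γ : (H.deleteEdges (H.incidenceSet p₃)).Path c p₄),
            if List.Disjoint α.1.support β.1.support ∧ List.Disjoint β.1.support γ.1.support then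
              ENNReal.ofReal (x ^ α.1.length) * ENNReal.ofReal (x ^ β.1.length) *
                ENNReal.ofReal (x ^ γ.1.length)
            else 0)
        + ENNReal.ofReal x ^ 3 *
          (∑' (a : H.neighborSet p₃) (b : H.neighborSet p₃) (c : H.neighborSet p₃)
              (α : (H.deleteEdges (H.incidenceSet p₃)).Path p₁ a)
              (β : (H.deleteEdges (H.incidenceSet p₃)).Path b p₂)
              (γ : (H.deleteEdges (H.incidenceSet p₃)).Path c p₄),
            if List.Disjoint β.1.support γ.1.support ∧ ¬ List.Disjoint α.1.support β.1.support then
              ENNReal.ofReal (x ^ α.1.length) * ENNReal.ofReal (x ^ β.1.length) *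
                ENNReal.ofReal (x ^ γ.1.length)
            else 0)) := by
  constructor
  · -- `V₁₂ Z₃₄`: two arms `α : p₁ → a`, `β : b → p₂` with `α ⊥ β`, times the free arm `γ : c → p₄`
    rw [pathKernelOn_visit_eq_tsum_arms H x hx p₁ p₂ p₃ h₁.symm h₂.symm,
      pathKernel_eq_tsum_firstArm H x hx p₃ p₄ h₄, ← mul_add,
      show ∀ A B : ℝ≥0∞, ENNReal.ofReal x ^ 2 * A * (ENNReal.ofReal x * B) =
        ENNReal.ofReal x ^ 3 * (A * B) from fun A B => by ring]
    congr 1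
    simp only [← ENNReal.tsum_mul_right]
    simp only [← ENNReal.tsum_mul_left]
    simp only [← ENNReal.tsum_add]
    refine tsum_congr fun a => tsum_congr fun b => ?_
    refine (tsum_comm₃ _).trans ?_
    refine tsum_congr fun c => tsum_congr fun α => tsum_congr fun β => tsum_congr fun γ => ?_
    by_cases hP : List.Disjoint α.1.support β.1.support <;>
      by_cases hQ : List.Disjoint β.1.support γ.1.support <;> simp [hP, hQ]
  · -- `V₂₄ Z₁₃`: two arms `β : b → p₂` (reversed), `γ : c → p₄` with `β ⊥ γ`, times the free arm `α`
    rw [pathKernelOn_visit_eq_tsum_arms' H x hx p₂ p₄ p₃ h₂.symm h₄.symm,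
      pathKernel_eq_tsum_lastArm H x hx p₁ p₃ h₁, ← mul_add,
      show ∀ A B : ℝ≥0∞, ENNReal.ofReal x ^ 2 * A * (ENNReal.ofReal x * B) =
        ENNReal.ofReal x ^ 3 * (B * A) from fun A B => by ring]
    congr 1
    simp only [← ENNReal.tsum_mul_right]
    simp only [← ENNReal.tsum_mul_left]
    simp only [← ENNReal.tsum_add]
    refine tsum_congr fun a => ?_
    refine ((tsum_comm₃ _).trans (tsum_comm₃ _)).trans ?_
    refine tsum_congr fun b => tsum_congr fun c => tsum_congr fun α => tsum_congr fun β =>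
      tsum_congr fun γ => ?_
    by_cases hP : List.Disjoint α.1.support β.1.support <;>
      by_cases hQ : List.Disjoint β.1.support γ.1.support <;> simp [hP, hQ, mul_assoc]

end Summit.CriticalPhenomena.SAWScalingLimit.Theorems.BoundaryTP2
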